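import Literature.Combinatorics.SimpleGraph.HamiltonianLOTCount
import Literature.Computability.Complexity.SharpSATNormalForm
import HarnessLib

/-!
# The `#3SAT → #HamPath` construction, V: the censuses cell by cell

Continuation of `HamiltonianLOTCount.lean`, which reduced the number of Hamiltonian paths of the
graph of `φ` to `#{σ | Φ₁ φ σ}`, `σ` ranging over the states of the `M` cells of the diamond chain.
Here `Φ₁` is evaluated gadget by gadget in terms of the cell states (`Φ₁_iff`): the diamond ladders
make every bus row uniform, the pins set the dummies, the hop ladders `h₄` set every door to the
negation of the value entering its row on its column, the set ladders compare consecutive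
occurrences of a variable, the clause links copy the negated column values into the clause cells,
and the clause gadgets read the literals.

## References

* M. Liśkiewicz, M. Ogihara, S. Toda, TCS 304 (2003) 129–156, §3 (Lemma 4).
-/

namespace Literature.Combinatorics.SimpleGraph

namespace LOTReduction

open Literature.Computability.Complexity Finset

variable {φ : CNF ℕ}

/-! ### Which slots the path of a chain state uses -/

section uses

variable {σ : Fin (M φ) → Bool} {i : ℕ}

/-- `UL` is used iff the state is `true`. [folklore] -/
theorem uses_slUL (hi : i < M φ) : Uses (pathOf (M φ) (extB σ)) (slUL i) ↔ extB σ i = true := uses_pathOf_pa hi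

/-- `UR` is used iff the state is `false`. [folklore] -/
theorem uses_slUR (hi : i < M φ) : Uses (pathOf (M φ) (extB σ)) (slUR i) ↔ extB σ i = false := uses_pathOf_aq hi

/-- `LL` is used iff the state is `false`. [folklore] -/
theorem uses_slLL (hi : i < M φ) : Uses (pathOf (M φ) (extB σ)) (slLL i) ↔ extB σ i = false := uses_pathOf_pb hi

/-- `LR` is used iff the state is `true`. [folklore] -/
theorem uses_slLR (hi : i < M φ) : Uses (pathOf (M φ) (extB σ)) (slLR i) ↔ extB σ i = true := uses_pathOf_bq hi

/-- The reversed `UL` is used iff the state is `true`. [folklore] -/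
theorem uses_slULrev (hi : i < M φ) : Uses (pathOf (M φ) (extB σ)) (slULrev i) ↔ extB σ i = true :=
  (uses_swap (e := slUL i)).trans (uses_slUL hi)

/-- The literal slot of clause cell `K_c` is used iff the state of `K_c` is the negated polarity. [folklore] -/
theorem uses_litSlot {c : ℕ} (hk : kIdx φ c < M φ) :
    Uses (pathOf (M φ) (extB σ)) (litSlot φ c) ↔ extB σ (kIdx φ c) = !FormulaCells.polOf φ c := by
  unfold litSlot
  split_ifs with hp
  · rw [uses_slLL hk, hp]; simp
  · rw [uses_slLR hk]; simp [hp]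

end uses

/-! ### Membership of slots in the canonical slot sets -/

/-- Slots of stage-1 gadgets are in `SB₁`. [folklore] -/
theorem mem_SB₁_of_mem_S {i : ℕ} (hi : i < n₁ φ) {e : ℕ × ℕ} (he : e ∈ (placed₁ φ i).S) : e ∈ SB₁ φ :=
  mem_SB₁.2 ⟨i, hi, he⟩

/-- Slots of stage-2 gadgets are in `SB₂`. [folklore] -/
theorem mem_SB₂_of_mem_S {i : ℕ} (hi : i < n₂ φ) {e : ℕ × ℕ} (he : e ∈ (placed₂ φ i).S) : e ∈ SB₂ φ :=
  mem_SB₂.2 ⟨i, hi, he⟩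

/-- A stage-1 slot is in `U₁of σ` iff used. [folklore] -/
theorem mem_U₁of_iff {σ : Fin (M φ) → Bool} {e : ℕ × ℕ} (he : e ∈ SB₁ φ) :
    e ∈ U₁of φ σ ↔ Uses (pathOf (M φ) (extB σ)) e :=
  ⟨fun h => (mem_U₁of.1 h).2, fun h => mem_U₁of.2 ⟨he, h⟩⟩

/-- A chain stage-2 slot is in `U₂of σ` iff used. [folklore] -/
theorem mem_U₂of_chain_iff {σ : Fin (M φ) → Bool} {e : ℕ × ℕ} (he : e ∈ SB₂ φ) (hn : ¬ IsHop φ e) :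
    e ∈ U₂of φ σ ↔ Uses (pathOf (M φ) (extB σ)) e := by
  rw [mem_U₂of, sel_of_not_isHop hn]
  exact ⟨fun h => h.2, fun h => ⟨he, h⟩⟩

/-- An upper hop edge is in `U₂of σ` iff the entry slot of its column is unused. [folklore] -/
theorem hopUL_mem_U₂of_iff {σ : Fin (M φ) → Bool} {r j k : ℕ} (hr : r < N φ) (hj : j < N φ) (hk : k < 4) :
    hopUL φ r j k ∈ U₂of φ σ ↔ ¬ Uses (pathOf (M φ) (extB σ)) (above φ r (J φ r j)) := by
  rw [mem_U₂of, sel_hopUL hj hk]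
  exact ⟨fun h => h.2, fun h => ⟨(hop_mem_SB₂ hr hj hk).1, h⟩⟩

/-- A lower hop edge is in `U₂of σ` iff the entry slot of its column is used. [folklore] -/
theorem hopLL_mem_U₂of_iff {σ : Fin (M φ) → Bool} {r j k : ℕ} (hr : r < N φ) (hj : j < N φ) (hk : k < 4) :
    hopLL φ r j k ∈ U₂of φ σ ↔ Uses (pathOf (M φ) (extB σ)) (above φ r (J φ r j)) := by
  rw [mem_U₂of, sel_hopLL hj hk]
  exact ⟨fun h => h.2, fun h => ⟨(hop_mem_SB₂ hr hj hk).2, h⟩⟩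

/-- Exactly one of two distinct elements, as a cardinality. [folklore] -/
theorem card_inter_pair_eq_one_iff {U : Finset (ℕ × ℕ)} {a b : ℕ × ℕ} (hab : a ≠ b) :
    (U ∩ {a, b}).card = 1 ↔ (a ∈ U ↔ b ∉ U) := by
  refine ⟨xor_of_card_inter_pair hab, fun h => ?_⟩
  rw [card_eq_one]
  by_cases ha : a ∈ U
  · refine ⟨a, ?_⟩
    ext x
    simp only [mem_inter, mem_insert, mem_singleton]
    constructor
    · rintro ⟨hx, rfl | rfl⟩
      · rfl
      · exact absurd hx (h.1 ha)
    · rintro rfl; exact ⟨ha, Or.inl rfl⟩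
  · have hb : b ∈ U := by by_contra hb; exact ha (h.2 hb)
    refine ⟨b, ?_⟩
    ext x
    simp only [mem_inter, mem_insert, mem_singleton]
    constructor
    · rintro ⟨hx, rfl | rfl⟩
      · exact absurd hx ha
      · rfl
    · rintro rfl; exact ⟨hb, Or.inr rfl⟩

/-- At least one element of `S`, as a cardinality. [folklore] -/
theorem card_inter_ne_zero_iff {U S : Finset (ℕ × ℕ)} : (U ∩ S).card ≠ 0 ↔ ∃ e ∈ S, e ∈ U := by
  rw [Ne, card_eq_zero, ← Ne, ← nonempty_iff_ne_empty]
  constructor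
  · rintro ⟨x, hx⟩; rw [mem_inter] at hx; exact ⟨x, hx.2, hx.1⟩
  · rintro ⟨x, hS, hU⟩; exact ⟨x, mem_inter.2 ⟨hU, hS⟩⟩

/-! ### Stage 1 evaluated -/

/-- Auxiliary index arithmetic for the sites. [folklore] -/
theorem site_div_mod {r j : ℕ} (hj : j < N φ) : (r * N φ + j) / N φ = r ∧ (r * N φ + j) % N φ = j := by
  constructor
  · rw [Nat.add_comm, Nat.add_mul_div_right _ _ (by omega), Nat.div_eq_of_lt hj]; simp
  · rw [Nat.add_comm, Nat.add_mul_mod_self_right, Nat.mod_eq_of_lt hj]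

/-- The slots of the diamond ladder of site `(r, j)`. [folklore] -/
theorem S_dl {r j : ℕ} (hr : r < N φ) (hj : j < N φ) :
    (placed₁ φ (r * N φ + j)).S = {slUR (blIdx φ r j), slULrev (brIdx φ r j)} := by
  have hlt : r * N φ + j < N φ * N φ := by
    calc r * N φ + j < r * N φ + N φ := by omega
      _ = (r + 1) * N φ := by ring
      _ ≤ N φ * N φ := Nat.mul_le_mul_right _ hr
  obtain ⟨hd, hm⟩ := site_div_mod (r := r) hj
  rw [placed₁_S]; unfold slots₁; rw [if_pos hlt, hd, hm]

/-- **The diamond ladder of site `(r, j)` passes iff its two bus cells have equal states** (the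
consistency of the selected hop edges being automatic). [folklore] -/
theorem specDL_iff (σ : Fin (M φ) → Bool) {r j : ℕ} (hr : r < N φ) (hj : j < N φ) :
    (placed₁ φ (r * N φ + j)).spec (U₁of φ σ ∩ (placed₁ φ (r * N φ + j)).S)
        (innerPart (placed₁ φ (r * N φ + j)).VX ((U₂of φ σ).filter (IsHop φ))) ↔
      extB σ (blIdx φ r j) = extB σ (brIdx φ r j) := by
  have hidx := site_lt_n₁ hr hj
  have hS := S_dl hr hj
  have hbl : blIdx φ r j < M φ := rowCell_lt_M hr (by omega)
  have hbr : brIdx φ r j < M φ := rowCell_lt_M hr (by omega)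
  have hne : slUR (blIdx φ r j) ≠ slULrev (brIdx φ r j) := by
    unfold slUR slULrev blIdx brIdx rowCell; simp only [ne_eq, Prod.ext_iff]; omega
  have ha : slUR (blIdx φ r j) ∈ SB₁ φ := mem_SB₁_of_mem_S hidx (by rw [hS]; simp)
  have hb : slULrev (brIdx φ r j) ∈ SB₁ φ := mem_SB₁_of_mem_S hidx (by rw [hS]; simp)
  have hcons : ∀ k < 4, (hopUL φ r j k ∈ innerPart (placed₁ φ (r * N φ + j)).VX ((U₂of φ σ).filter (IsHop φ)) ↔
      hopLL φ r j k ∉ innerPart (placed₁ φ (r * N φ + j)).VX ((U₂of φ σ).filter (IsHop φ))) := by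
    intro k hk
    have hV := hop_ends_mem_VX (φ := φ) hr hj hk
    have hh := isHop_hop (φ := φ) (r := r) (j := j) (k := k)
    simp only [mem_innerPart, mem_filter, hh.1, hh.2, hV.1, hV.2.1, hV.2.2.1, hV.2.2.2, and_true]
    rw [hopUL_mem_U₂of_iff hr hj hk, hopLL_mem_U₂of_iff hr hj hk]
  rw [placed₁_spec_dl hr hj, hS, card_inter_pair_eq_one_iff hne, mem_U₁of_iff ha, mem_U₁of_iff hb,
    uses_slUR hbl, uses_slULrev hbr]
  constructor
  · rintro ⟨h, -⟩
    cases h1 : extB σ (blIdx φ r j) <;> cases h2 : extB σ (brIdx φ r j) <;> simp_all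
  · intro h
    refine ⟨?_, hcons⟩
    rw [h]
    cases extB σ (brIdx φ r j) <;> simp

/-- **A pin passes iff its dummy cell is `true`.** [folklore] -/
theorem specPin_iff (σ : Fin (M φ) → Bool) {d : ℕ} (hd : d < 2 * N φ) (RX : Finset (ℕ × ℕ)) :
    (placed₁ φ (N φ * N φ + d)).spec (U₁of φ σ ∩ (placed₁ φ (N φ * N φ + d)).S) RX ↔ extB σ d = true := by
  have hidx : N φ * N φ + d < n₁ φ := by unfold n₁; omega
  have hS : (placed₁ φ (N φ * N φ + d)).S = {slUL d} := by
    rw [placed₁_S]; unfold slots₁; rw [if_neg (by omega), if_pos (by omega), Nat.add_sub_cancel_left]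
  have hdM : d < M φ := by unfold M; omega
  rw [placed₁_spec_pin hd, hS, card_inter_ne_zero_iff]
  simp only [mem_singleton, exists_eq_left]
  rw [mem_U₁of_iff (mem_SB₁_of_mem_S hidx (by rw [hS]; simp)), uses_slUL hdM]

/-- **The unit-clause gadget passes iff the literal of cell `0` is true.** [folklore] -/
theorem specClause1_iff (σ : Fin (M φ) → Bool) (RX : Finset (ℕ × ℕ)) :
    (placed₁ φ (N φ * N φ + 2 * N φ)).spec (U₁of φ σ ∩ (placed₁ φ (N φ * N φ + 2 * N φ)).S) RX ↔
      extB σ (kIdx φ 0) = !FormulaCells.polOf φ 0 := by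
  have hidx : N φ * N φ + 2 * N φ < n₁ φ := by unfold n₁; omega
  have hS : (placed₁ φ (N φ * N φ + 2 * N φ)).S = {litSlot φ 0} := by
    rw [placed₁_S]; unfold slots₁; rw [if_neg (by omega), if_neg (by omega), if_pos rfl]
  rw [placed₁_spec_clause1, hS, card_inter_ne_zero_iff]
  simp only [mem_singleton, exists_eq_left]
  rw [mem_U₁of_iff (mem_SB₁_of_mem_S hidx (by rw [hS]; simp)), uses_litSlot (kIdx_zero_lt_M φ)]

/-- **A three-clause gadget passes iff one of its literals is true.** [folklore] -/
theorem specOr3_iff (σ : Fin (M φ) → Bool) {t : ℕ} (ht : t < T φ) (RX : Finset (ℕ × ℕ)) :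
    (placed₁ φ (N φ * N φ + 2 * N φ + 1 + t)).spec (U₁of φ σ ∩ (placed₁ φ (N φ * N φ + 2 * N φ + 1 + t)).S) RX ↔
      ∃ u < 3, extB σ (kIdx φ (3 * t + 1 + u)) = !FormulaCells.polOf φ (3 * t + 1 + u) := by
  have hidx : N φ * N φ + 2 * N φ + 1 + t < n₁ φ := by unfold n₁; omega
  have hS : (placed₁ φ (N φ * N φ + 2 * N φ + 1 + t)).S =
      Finset.univ.image fun u : Fin 3 => litSlot φ (3 * t + 1 + u.val) := by
    rw [placed₁_S]; unfold slots₁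
    rw [if_neg (by omega), if_neg (by omega), if_neg (by omega), if_pos hidx, Nat.add_sub_cancel_left]
  rw [placed₁_spec_or3 ht, card_inter_ne_zero_iff]
  constructor
  · rintro ⟨e, he, heU⟩
    have he' := he
    rw [hS, mem_image] at he'
    obtain ⟨u, -, rfl⟩ := he'
    have hk : kIdx φ (3 * t + 1 + u.val) < M φ := kIdx_lt_M (by have := u.isLt; unfold T at ht; omega)
    exact ⟨u.val, u.isLt, (uses_litSlot hk).1 ((mem_U₁of_iff (mem_SB₁_of_mem_S hidx he)).1 heU)⟩
  · rintro ⟨u, hu, h⟩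
    have he : litSlot φ (3 * t + 1 + u) ∈ (placed₁ φ (N φ * N φ + 2 * N φ + 1 + t)).S := by
      rw [hS, mem_image]; exact ⟨⟨u, hu⟩, mem_univ _, rfl⟩
    have hk : kIdx φ (3 * t + 1 + u) < M φ := kIdx_lt_M (by unfold T at ht; omega)
    exact ⟨_, he, (mem_U₁of_iff (mem_SB₁_of_mem_S hidx he)).2 ((uses_litSlot hk).2 h)⟩

/-! ### Stage 2 evaluated -/

/-- **The hop ladders `h₀ … h₃` always pass** on the canonical slot sets. [folklore] -/
theorem cardHop_lt (σ : Fin (M φ) → Bool) {c r h : ℕ} (hc : c < N φ) (hr : r < N φ) (hh : h < 4) :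
    (U₂of φ σ ∩ (placed₂ φ (5 * (c * N φ + r) + h)).S).card = 1 := by
  obtain ⟨hsp, hlt⟩ := slotPair₂_hop hc hr (show h < 5 by omega)
  have hj : J φ r c < N φ := J_lt hc
  rw [placed₂_S hlt, hsp, card_inter_pair_eq_one_iff (hopSlots_ne hc hr (by omega))]
  have v_iff : (above φ r c).swap ∈ U₂of φ σ ↔ Uses (pathOf (M φ) (extB σ)) (above φ r c) :=
    (mem_U₂of_chain_iff (above_swap_mem_SB₂ hr hc) (not_isHop_above_swap hr hc)).trans uses_swap
  have hU : ∀ k < 4, (hopUL φ r (J φ r c) k ∈ U₂of φ σ ↔ ¬ Uses (pathOf (M φ) (extB σ)) (above φ r c)) :=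
    fun k hk => by rw [hopUL_mem_U₂of_iff hr hj hk, J_J hc]
  have hL : ∀ k < 4, (hopLL φ r (J φ r c) k ∈ U₂of φ σ ↔ Uses (pathOf (M φ) (extB σ)) (above φ r c)) :=
    fun k hk => by rw [hopLL_mem_U₂of_iff hr hj hk, J_J hc]
  unfold hopSlots'
  rcases Nat.eq_zero_or_eq_succ_pred h with h0 | hsucc
  · subst h0
    rw [if_pos rfl]; dsimp only
    rw [v_iff, hU 0 (by omega), not_not]
  · set k := h.pred with hk
    rw [hsucc, if_neg (Nat.succ_ne_zero k)]
    unfold hopSlots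
    rw [if_neg (Nat.succ_ne_zero k), if_neg (by omega), Nat.succ_sub_one]
    dsimp only
    rw [hL k (by omega), hU (k + 1) (by omega), not_not]

/-- The door slot `W.UL` of a site is a chain stage-2 slot. [folklore] -/
theorem wUL_mem_SB₂ {c r : ℕ} (hc : c < N φ) (hr : r < N φ) :
    slUL (wIdx φ r (J φ r c)) ∈ SB₂ φ ∧ ¬ IsHop φ (slUL (wIdx φ r (J φ r c))) := by
  obtain ⟨hsp, hlt⟩ := slotPair₂_hop hc hr (show 4 < 5 by omega)
  refine ⟨mem_SB₂_of_mem_S hlt ?_, ?_⟩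
  · rw [placed₂_S hlt, hsp]; unfold hopSlots' hopSlots; rw [if_neg (by omega), if_neg (by omega), if_pos rfl]; simp
  · have := five_cell_lt_base1 φ (rowCell_lt_M hr (k := 2 * J φ r c + 1) (by have := J_lt (r := r) hc; omega))
    unfold IsHop slUL wIdx; dsimp only; omega

/-- **The hop ladder `h₄` passes iff the door is the negation of the value entering the row.** [folklore] -/
theorem cardHop_four_iff (σ : Fin (M φ) → Bool) {c r : ℕ} (hc : c < N φ) (hr : r < N φ) :
    (U₂of φ σ ∩ (placed₂ φ (5 * (c * N φ + r) + 4)).S).card = 1 ↔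
      (extB σ (wIdx φ r (J φ r c)) = true ↔ ¬ Uses (pathOf (M φ) (extB σ)) (above φ r c)) := by
  obtain ⟨hsp, hlt⟩ := slotPair₂_hop hc hr (show 4 < 5 by omega)
  have hj : J φ r c < N φ := J_lt hc
  obtain ⟨hW, hWn⟩ := wUL_mem_SB₂ hc hr
  have hWM : wIdx φ r (J φ r c) < M φ := rowCell_lt_M hr (by omega)
  rw [placed₂_S hlt, hsp, card_inter_pair_eq_one_iff (hopSlots_ne hc hr (by omega))]
  unfold hopSlots' hopSlots
  rw [if_neg (by omega), if_neg (by omega), if_pos rfl]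
  dsimp only
  rw [hopLL_mem_U₂of_iff hr hj (by omega), J_J hc, mem_U₂of_chain_iff hW hWn, uses_slUL hWM]
  exact iff_not_comm

variable (φ) in
/-- **The set-ladder condition of column `c`**: with a previous occurrence, the door of site
`(c, J c c)` is `false` iff the bus cell to its right is not (`W ≠ Br`); without, the vacuous
condition on the two dummies (`D_c` true or `D'_c` false, exclusively). [folklore] -/
def SetOK (σ : Fin (M φ) → Bool) (c : ℕ) : Prop :=
  if (prev? φ c).isSome then (extB σ (wIdx φ c (J φ c c)) = false ↔ ¬ extB σ (brIdx φ c (J φ c c)) = false)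
  else (extB σ (dIdx c) = true ↔ ¬ extB σ (d'Idx c) = false)

/-- The slots of the set ladder of column `c`. [folklore] -/
theorem S_set {c : ℕ} (hc : c < N φ) :
    (placed₂ φ (5 * (N φ * N φ) + c)).S = {(setSlots' φ c).1, (setSlots' φ c).2} ∧ 5 * (N φ * N φ) + c < n₂ φ := by
  have hlt : 5 * (N φ * N φ) + c < n₂ φ := by unfold n₂; omega
  refine ⟨?_, hlt⟩
  rw [placed₂_S hlt]; unfold slotPair₂
  rw [if_neg (by omega), if_pos (by omega), Nat.add_sub_cancel_left]

/-- **The set ladder of column `c` passes iff `SetOK`.** [folklore] -/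
theorem cardSet_iff (σ : Fin (M φ) → Bool) {c : ℕ} (hc : c < N φ) :
    (U₂of φ σ ∩ (placed₂ φ (5 * (N φ * N φ) + c)).S).card = 1 ↔ SetOK φ σ c := by
  obtain ⟨hS, hlt⟩ := S_set hc
  have hb := setSlots'_ok (φ := φ) hc
  have hne : (setSlots' φ c).1 ≠ (setSlots' φ c).2 := fun h => hb.2.2.1 (congrArg Prod.fst h)
  have h1 : (setSlots' φ c).1 ∈ SB₂ φ := mem_SB₂_of_mem_S hlt (by rw [hS]; simp)
  have h2 : (setSlots' φ c).2 ∈ SB₂ φ := mem_SB₂_of_mem_S hlt (by rw [hS]; simp)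
  have hlt1 := setSlots'_lt_base1 (φ := φ) hc
  have hn1 : ¬ IsHop φ (setSlots' φ c).1 := by unfold IsHop; omega
  have hn2 : ¬ IsHop φ (setSlots' φ c).2 := by unfold IsHop; omega
  rw [hS, card_inter_pair_eq_one_iff hne, mem_U₂of_chain_iff h1 hn1, mem_U₂of_chain_iff h2 hn2]
  have hj := J_lt (r := c) hc
  unfold SetOK setSlots'
  by_cases hp : (prev? φ c).isSome
  · rw [if_pos hp, if_pos hp]; dsimp only
    rw [uses_slLL (show wIdx φ c (J φ c c) < M φ from rowCell_lt_M hc (by omega)), uses_swap,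
      uses_slLL (show brIdx φ c (J φ c c) < M φ from rowCell_lt_M hc (by omega))]
  · rw [if_neg hp, if_neg hp]; dsimp only
    rw [uses_slLR (dIdx_lt_M hc), uses_swap, uses_slLL (d'Idx_lt_M hc)]

/-- The slots of the clause link of column `c`. [folklore] -/
theorem S_klink {c : ℕ} (hc : c < N φ) :
    (placed₂ φ (5 * (N φ * N φ) + N φ + c)).S = {(below φ (N φ - 1) c).swap, slUL (kIdx φ c)} ∧
      5 * (N φ * N φ) + N φ + c < n₂ φ := by
  have hlt : 5 * (N φ * N φ) + N φ + c < n₂ φ := by unfold n₂; omega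
  refine ⟨?_, hlt⟩
  rw [placed₂_S hlt]; unfold slotPair₂
  rw [if_neg (by omega), if_neg (by omega), Nat.add_sub_cancel_left]
  rfl

/-- **The clause link of column `c` passes iff `K_c` is the negation of the value leaving the last row.** [folklore] -/
theorem cardKlink_iff (σ : Fin (M φ) → Bool) {c : ℕ} (hc : c < N φ) :
    (U₂of φ σ ∩ (placed₂ φ (5 * (N φ * N φ) + N φ + c)).S).card = 1 ↔
      (Uses (pathOf (M φ) (extB σ)) (below φ (N φ - 1) c) ↔ ¬ extB σ (kIdx φ c) = true) := by
  obtain ⟨hS, hlt⟩ := S_klink hc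
  have hb := klinkSlots'_ok (φ := φ) hc
  unfold klinkSlots' at hb
  have hne : (below φ (N φ - 1) c).swap ≠ slUL (kIdx φ c) := fun h => hb.2.2.1 (congrArg Prod.fst h)
  have h1 : (below φ (N φ - 1) c).swap ∈ SB₂ φ := mem_SB₂_of_mem_S hlt (by rw [hS]; simp)
  have h2 : slUL (kIdx φ c) ∈ SB₂ φ := mem_SB₂_of_mem_S hlt (by rw [hS]; simp)
  have hbel := below_bounds (φ := φ) (r := N φ - 1) (by omega) hc
  have hn1 : ¬ IsHop φ (below φ (N φ - 1) c).swap := by unfold IsHop; simp only [Prod.fst_swap]; omega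
  have hn2 : ¬ IsHop φ (slUL (kIdx φ c)) := by
    have := five_cell_lt_base1 φ (kIdx_lt_M hc); unfold IsHop slUL; dsimp only; omega
  rw [hS, card_inter_pair_eq_one_iff hne, mem_U₂of_chain_iff h1 hn1, uses_swap, mem_U₂of_chain_iff h2 hn2,
    uses_slUL (kIdx_lt_M hc)]

/-! ### The collapsed constraint, cell by cell -/

variable (φ) in
/-- **The stage-2 conditions on a chain state**: doors, set ladders, clause links. [folklore] -/
def OKA (σ : Fin (M φ) → Bool) : Prop :=
  (∀ c < N φ, ∀ r < N φ, (extB σ (wIdx φ r (J φ r c)) = true ↔ ¬ Uses (pathOf (M φ) (extB σ)) (above φ r c))) ∧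
    (∀ c < N φ, SetOK φ σ c) ∧
    ∀ c < N φ, (Uses (pathOf (M φ) (extB σ)) (below φ (N φ - 1) c) ↔ ¬ extB σ (kIdx φ c) = true)

variable (φ) in
/-- **The stage-1 conditions on a chain state**: uniform bus rows, dummies `true`, clauses read. [folklore] -/
def OKB (σ : Fin (M φ) → Bool) : Prop :=
  (∀ r < N φ, ∀ j < N φ, extB σ (blIdx φ r j) = extB σ (brIdx φ r j)) ∧
    (∀ d < 2 * N φ, extB σ d = true) ∧
    extB σ (kIdx φ 0) = !FormulaCells.polOf φ 0 ∧
    ∀ t < T φ, ∃ u < 3, extB σ (kIdx φ (3 * t + 1 + u)) = !FormulaCells.polOf φ (3 * t + 1 + u)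

/-- Quantifying over the stage-1 indices. [folklore] -/
theorem forall_range_n₁ {P : ℕ → Prop} : (∀ i ∈ range (n₁ φ), P i) ↔
    (∀ r < N φ, ∀ j < N φ, P (r * N φ + j)) ∧ (∀ d < 2 * N φ, P (N φ * N φ + d)) ∧ P (N φ * N φ + 2 * N φ) ∧
      ∀ t < T φ, P (N φ * N φ + 2 * N φ + 1 + t) := by
  constructor
  · intro h
    exact ⟨fun r hr j hj => h _ (mem_range.2 (site_lt_n₁ hr hj)), fun d hd => h _ (mem_range.2 (by unfold n₁; omega)),
      h _ (mem_range.2 (by unfold n₁; omega)), fun t ht => h _ (mem_range.2 (by unfold n₁; omega))⟩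
  · rintro ⟨h1, h2, h3, h4⟩ i hi
    rw [mem_range] at hi
    by_cases hi1 : i < N φ * N φ
    · obtain ⟨hr, hj⟩ := dl_site_lt φ hi1
      have := h1 _ hr _ hj
      rwa [Nat.div_add_mod' i (N φ)] at this
    by_cases hi2 : i < N φ * N φ + 2 * N φ
    · have := h2 (i - N φ * N φ) (by omega)
      rwa [show N φ * N φ + (i - N φ * N φ) = i by omega] at this
    by_cases hi3 : i = N φ * N φ + 2 * N φ
    · rw [hi3]; exact h3
    · have := h4 (i - (N φ * N φ + 2 * N φ + 1)) (by unfold n₁ at hi; omega)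
      rwa [show N φ * N φ + 2 * N φ + 1 + (i - (N φ * N φ + 2 * N φ + 1)) = i by omega] at this

/-- Quantifying over the stage-2 indices. [folklore] -/
theorem forall_range_n₂ {P : ℕ → Prop} : (∀ i ∈ range (n₂ φ), P i) ↔
    (∀ c < N φ, ∀ r < N φ, ∀ h < 5, P (5 * (c * N φ + r) + h)) ∧ (∀ c < N φ, P (5 * (N φ * N φ) + c)) ∧
      ∀ c < N φ, P (5 * (N φ * N φ) + N φ + c) := by
  constructor
  · intro h
    exact ⟨fun c hc r hr k hk => h _ (mem_range.2 (slotPair₂_hop hc hr hk).2),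
      fun c hc => h _ (mem_range.2 (by unfold n₂; omega)), fun c hc => h _ (mem_range.2 (by unfold n₂; omega))⟩
  · rintro ⟨h1, h2, h3⟩ i hi
    rw [mem_range] at hi
    by_cases hi1 : i < 5 * (N φ * N φ)
    · obtain ⟨hc, hr, hh, -⟩ := hop_idx_lt hi1
      have := h1 _ hc _ hr _ hh
      rwa [Nat.div_add_mod' (i / 5) (N φ), Nat.div_add_mod i 5] at this
    by_cases hi2 : i < 5 * (N φ * N φ) + N φ
    · have := h2 (i - 5 * (N φ * N φ)) (by omega)
      rwa [show 5 * (N φ * N φ) + (i - 5 * (N φ * N φ)) = i by omega] at this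
    · have := h3 (i - (5 * (N φ * N φ) + N φ)) (by unfold n₂ at hi; omega)
      rwa [show 5 * (N φ * N φ) + N φ + (i - (5 * (N φ * N φ) + N φ)) = i by omega] at this

/-- **The collapsed constraint `Φ₁`, cell by cell.** [cite: LiskiewiczOgiharaToda2003, §3 (Lemma 4)] -/
theorem Φ₁_iff (σ : Fin (M φ) → Bool) : Φ₁ φ σ ↔ OKA φ σ ∧ OKB φ σ := by
  unfold Φ₁ A₂ B₁ OKA OKB
  rw [forall_range_n₂, forall_range_n₁]
  refine and_congr (and_congr ?_ (and_congr ?_ ?_)) (and_congr ?_ (and_congr ?_ (and_congr ?_ ?_)))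
  · refine forall₂_congr fun c hc => forall₂_congr fun r hr => ?_
    constructor
    · intro h; exact (cardHop_four_iff σ hc hr).1 (h 4 (by omega))
    · intro h k hk
      by_cases hk4 : k = 4
      · rw [hk4]; exact (cardHop_four_iff σ hc hr).2 h
      · exact cardHop_lt σ hc hr (by omega)
  · exact forall₂_congr fun c hc => cardSet_iff σ hc
  · exact forall₂_congr fun c hc => cardKlink_iff σ hc
  · exact forall₂_congr fun r hr => forall₂_congr fun j hj => specDL_iff σ hr hj
  · exact forall₂_congr fun d hd => specPin_iff σ hd _
  · exact specClause1_iff σ _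
  · exact forall₂_congr fun t ht => specOr3_iff σ ht _

/-! ### The column values -/

variable (φ) in
/-- **The value entering row `r` on column `c`** when the bus rows carry `τ`: `false` above the
first tap row, and the bus value of the last tap row above `r` otherwise. [folklore] -/
def V (τ : ℕ → Bool) : ℕ → ℕ → Bool
  | 0, _ => false
  | r + 1, c => if IsTap φ r c then τ r else V τ r c

/-- `V` at row `0`. [folklore] -/
theorem V_zero (τ : ℕ → Bool) (c : ℕ) : V φ τ 0 c = false := rfl

/-- `V` at a successor row. [folklore] -/
theorem V_succ (τ : ℕ → Bool) (r c : ℕ) : V φ τ (r + 1) c = if IsTap φ r c then τ r else V φ τ r c := rfl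

/-- `V` is constant across rows without taps. [folklore] -/
theorem V_eq_of_noTap {τ : ℕ → Bool} {c r₀ : ℕ} :
    ∀ {r : ℕ}, r₀ ≤ r → (∀ r', r₀ ≤ r' → r' < r → ¬ IsTap φ r' c) → V φ τ r c = V φ τ r₀ c
  | 0, h, _ => by obtain rfl : r₀ = 0 := (by omega); rfl
  | r + 1, h, hno => by
    by_cases he : r₀ = r + 1
    · rw [he]
    · rw [V_succ, if_neg (hno r (by omega) (by omega))]
      exact V_eq_of_noTap (by omega) fun r' h1 h2 => hno r' h1 (by omega)

/-- No taps below the cell's own row. [folklore] -/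
theorem not_isTap_of_lt {c r : ℕ} (h : c < r) : ¬ IsTap φ r c := by
  rintro (h1 | h2)
  · omega
  · have := (prev?_spec h2).1; omega

/-- **The value leaving the last row on column `c` is the bus value of row `c`.** [folklore] -/
theorem V_N {τ : ℕ → Bool} {c : ℕ} (hc : c < N φ) : V φ τ (N φ) c = τ c := by
  rw [V_eq_of_noTap (r₀ := c + 1) hc (fun r' h1 _ => not_isTap_of_lt (by omega)), V_succ,
    if_pos (show IsTap φ c c from Or.inl rfl)]

/-- **The value entering row `c` on column `c` is the bus value of the previous occurrence.** [folklore] -/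
theorem V_self {τ : ℕ → Bool} {c p : ℕ} (hp : prev? φ c = some p) : V φ τ c c = τ p := by
  have hpc := (prev?_spec hp).1
  rw [V_eq_of_noTap (r₀ := p + 1) hpc (fun r' h1 h2 => ?_), V_succ, if_pos (show IsTap φ p c from Or.inr hp)]
  rintro (h | h)
  · omega
  · rw [hp, Option.some.injEq] at h; omega

/-- `V` depends on `τ` only below `N` (on the columns below `N`). [folklore] -/
theorem V_congr {τ τ' : ℕ → Bool} (h : ∀ r < N φ, τ r = τ' r) {c : ℕ} (hc : c < N φ) : ∀ r, V φ τ r c = V φ τ' r c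
  | 0 => rfl
  | r + 1 => by
    rw [V_succ, V_succ, V_congr h hc r]
    by_cases ht : IsTap φ r c
    · have hr : r < N φ := by
        rcases ht with h1 | h2
        · omega
        · have := (prev?_spec h2).1; omega
      rw [if_pos ht, if_pos ht, h r hr]
    · rw [if_neg ht, if_neg ht]

/-! ### The configuration of a bus assignment -/

variable (φ) in
/-- **The cell states determined by bus values `τ` and the free cell's state `z`**: dummies `true`,
bus cells of row `r` at `τ r`, the door of site `(r, j)` at the negation of the value entering row `r`
on the column through the site, the clause cell `K_c` at the negation of the value leaving the last
row on column `c`, the free cell at `z`. [folklore] -/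
def confFun (τ : ℕ → Bool) (z : Bool) (i : ℕ) : Bool :=
  if i < 2 * N φ then true
  else if i < 2 * N φ + N φ * (2 * N φ + 1) then
    (if (i - 2 * N φ) % (2 * N φ + 1) % 2 = 0 then τ ((i - 2 * N φ) / (2 * N φ + 1))
      else ! V φ τ ((i - 2 * N φ) / (2 * N φ + 1))
        (J φ ((i - 2 * N φ) / (2 * N φ + 1)) ((i - 2 * N φ) % (2 * N φ + 1) / 2)))
  else if i < zIdx φ then ! V φ τ (N φ) (i - (2 * N φ + N φ * (2 * N φ + 1)))
  else z

variable (φ) in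
/-- Extension of a bus assignment to all of `ℕ`. [folklore] -/
def extT (τ : Fin (N φ) → Bool) (r : ℕ) : Bool := if h : r < N φ then τ ⟨r, h⟩ else false

variable (φ) in
/-- **The chain state of a bus assignment and a free bit.** [folklore] -/
def conf (p : (Fin (N φ) → Bool) × Bool) : Fin (M φ) → Bool := fun i => confFun φ (extT φ p.1) p.2 i.val

section confEval

variable {τ : ℕ → Bool} {z : Bool}

/-- Dummies are `true`. [folklore] -/
theorem confFun_dummy {d : ℕ} (hd : d < 2 * N φ) : confFun φ τ z d = true := by
  unfold confFun; rw [if_pos hd]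

/-- Row cells. [folklore] -/
theorem confFun_rowCell {r k : ℕ} (hr : r < N φ) (hk : k ≤ 2 * N φ) :
    confFun φ τ z (rowCell φ r k) = if k % 2 = 0 then τ r else ! V φ τ r (J φ r (k / 2)) := by
  have hlo := le_rowCell (φ := φ) r k
  have hhi := rowCell_lt hr hk
  obtain ⟨hq, hrem⟩ := rowCell_div_mod (φ := φ) (r := r) (k := k) hk
  unfold confFun
  rw [if_neg (by omega), if_pos hhi, hq, hrem]

/-- Bus cells `Bl`. [folklore] -/
theorem confFun_bl {r j : ℕ} (hr : r < N φ) (hj : j ≤ N φ) : confFun φ τ z (blIdx φ r j) = τ r := by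
  unfold blIdx; rw [confFun_rowCell hr (by omega), if_pos (by omega)]

/-- Bus cells `Br`. [folklore] -/
theorem confFun_br {r j : ℕ} (hr : r < N φ) (hj : j < N φ) : confFun φ τ z (brIdx φ r j) = τ r := by
  unfold brIdx; rw [confFun_rowCell hr (by omega), if_pos (by omega)]

/-- Doors. [folklore] -/
theorem confFun_w {r j : ℕ} (hr : r < N φ) (hj : j < N φ) : confFun φ τ z (wIdx φ r j) = ! V φ τ r (J φ r j) := by
  unfold wIdx; rw [confFun_rowCell hr (by omega), if_neg (by omega), show (2 * j + 1) / 2 = j by omega]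

/-- Clause cells. [folklore] -/
theorem confFun_k {c : ℕ} (hc : c < N φ) : confFun φ τ z (kIdx φ c) = ! V φ τ (N φ) c := by
  have h1 := le_kIdx (φ := φ) c
  have h2 := kIdx_lt (φ := φ) hc
  unfold confFun
  rw [if_neg (by omega), if_neg (by omega), if_pos h2]
  unfold kIdx
  rw [Nat.add_sub_cancel_left]

/-- The free cell. [folklore] -/
theorem confFun_z : confFun φ τ z (zIdx φ) = z := by
  have := le_kIdx (φ := φ) 0
  unfold confFun
  rw [if_neg (by unfold zIdx; omega), if_neg (by unfold zIdx; omega), if_neg (lt_irrefl _)]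

end confEval

/-- The chain state of `(τ, z)`, cell-wise. [folklore] -/
theorem extB_conf (p : (Fin (N φ) → Bool) × Bool) {i : ℕ} (hi : i < M φ) :
    extB (conf φ p) i = confFun φ (extT φ p.1) p.2 i := by
  unfold extB; rw [dif_pos hi]; rfl

/-- Every cell is a dummy, a row cell, a clause cell or the free cell. [folklore] -/
theorem cell_cases {i : ℕ} (hi : i < M φ) :
    i < 2 * N φ ∨ (∃ r < N φ, ∃ k ≤ 2 * N φ, i = rowCell φ r k) ∨ (∃ c < N φ, i = kIdx φ c) ∨ i = zIdx φ := by
  by_cases h1 : i < 2 * N φ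
  · exact Or.inl h1
  by_cases h2 : i < 2 * N φ + N φ * (2 * N φ + 1)
  · refine Or.inr (Or.inl ⟨(i - 2 * N φ) / (2 * N φ + 1), ?_, (i - 2 * N φ) % (2 * N φ + 1), ?_, ?_⟩)
    · apply Nat.div_lt_of_lt_mul
      rw [Nat.mul_comm (2 * N φ + 1) (N φ)]
      omega
    · have := Nat.mod_lt (i - 2 * N φ) (show 0 < 2 * N φ + 1 by omega); omega
    · have := Nat.div_add_mod' (i - 2 * N φ) (2 * N φ + 1)
      unfold rowCell rowStart; omega
  by_cases h3 : i < zIdx φ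
  · refine Or.inr (Or.inr (Or.inl ⟨i - (2 * N φ + N φ * (2 * N φ + 1)), by unfold zIdx at h3; omega, ?_⟩))
    unfold kIdx; omega
  · have h4 := zIdx_eq (φ := φ)
    exact Or.inr (Or.inr (Or.inr (by omega)))

/-! ### From the conditions to the configuration -/

/-- Uniform bus rows: every bus cell of row `r` has the state of the first one. [folklore] -/
theorem bus_eq {σ : Fin (M φ) → Bool} (hB : ∀ r < N φ, ∀ j < N φ, extB σ (blIdx φ r j) = extB σ (brIdx φ r j))
    {r : ℕ} (hr : r < N φ) : ∀ {j : ℕ}, j ≤ N φ → extB σ (blIdx φ r j) = extB σ (blIdx φ r 0)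
  | 0, _ => rfl
  | j + 1, hj => by
    rw [show blIdx φ r (j + 1) = brIdx φ r j by unfold blIdx brIdx; rw [show 2 * (j + 1) = 2 * j + 2 by ring],
      ← hB r hr j (by omega)]
    exact bus_eq hB hr (by omega)

/-- **The entry slots under the conditions**: `above r c` is used iff the value entering row `r` on
column `c` is `true` (induction down the column). [folklore] -/
theorem uses_above_of_OK {σ : Fin (M φ) → Bool} {τ : ℕ → Bool}
    (hA1 : ∀ c < N φ, ∀ r < N φ, (extB σ (wIdx φ r (J φ r c)) = true ↔ ¬ Uses (pathOf (M φ) (extB σ)) (above φ r c)))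
    (hB1 : ∀ r < N φ, ∀ j < N φ, extB σ (blIdx φ r j) = extB σ (brIdx φ r j))
    (hB2 : ∀ d < 2 * N φ, extB σ d = true) (hτ : ∀ r < N φ, τ r = extB σ (blIdx φ r 0))
    {c : ℕ} (hc : c < N φ) :
    ∀ r : ℕ, r ≤ N φ → (Uses (pathOf (M φ) (extB σ)) (above φ r c) ↔ V φ τ r c = true)
  | 0, _ => by
    unfold above
    rw [if_pos rfl, uses_slLL (dIdx_lt_M hc), hB2 _ (dIdx_lt hc), V_zero]
    simp
  | r + 1, hr => by
    have hr' : r < N φ := by omega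
    have hj := J_lt (r := r) hc
    have ih := uses_above_of_OK hA1 hB1 hB2 hτ hc r (by omega)
    unfold above
    rw [if_neg (Nat.succ_ne_zero r), Nat.add_sub_cancel, V_succ]
    unfold below
    split_ifs with ht
    · rw [uses_slLR (show blIdx φ r (J φ r c) < M φ from rowCell_lt_M hr' (by omega)), bus_eq hB1 hr' hj.le, hτ r hr']
    · rw [uses_slLL (show wIdx φ r (J φ r c) < M φ from rowCell_lt_M hr' (by omega))]
      have h := hA1 c hc r hr'
      rw [ih] at h
      revert h
      cases extB σ (wIdx φ r (J φ r c)) <;> cases V φ τ r c <;> simp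

/-- **The entry slots of a configuration**: `above r c` is used iff `V τ r c`. [folklore] -/
theorem uses_above_conf {σ : Fin (M φ) → Bool} {τ : ℕ → Bool} {z : Bool}
    (hσ : ∀ i < M φ, extB σ i = confFun φ τ z i) {c : ℕ} (hc : c < N φ) :
    ∀ r : ℕ, r ≤ N φ → (Uses (pathOf (M φ) (extB σ)) (above φ r c) ↔ V φ τ r c = true)
  | 0, _ => by
    unfold above
    rw [if_pos rfl, uses_slLL (dIdx_lt_M hc), hσ _ (dIdx_lt_M hc), show dIdx c = 2 * c from rfl,
      confFun_dummy (by omega), V_zero]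
    simp
  | r + 1, hr => by
    have hr' : r < N φ := by omega
    have hj := J_lt (r := r) hc
    unfold above
    rw [if_neg (Nat.succ_ne_zero r), Nat.add_sub_cancel, V_succ]
    unfold below
    split_ifs with ht
    · have hM : blIdx φ r (J φ r c) < M φ := rowCell_lt_M hr' (by omega)
      rw [uses_slLR hM, hσ _ hM, confFun_bl hr' hj.le]
    · have hM : wIdx φ r (J φ r c) < M φ := rowCell_lt_M hr' (by omega)
      rw [uses_slLL hM, hσ _ hM, confFun_w hr' hj, J_J hc]
      cases V φ τ r c <;> simp

variable (φ) in
/-- **Goodness of a bus assignment, cell-wise**: consecutive occurrences of a variable agree, and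
every clause has a true literal (the unit clause: cell `0`; clause `t + 1`: cells `3t+1, 3t+2, 3t+3`). [folklore] -/
def GoodC (τ : Fin (N φ) → Bool) : Prop :=
  (∀ c < N φ, ∀ p, prev? φ c = some p → extT φ τ p = extT φ τ c) ∧
    extT φ τ 0 = FormulaCells.polOf φ 0 ∧
    ∀ t < T φ, ∃ u < 3, extT φ τ (3 * t + 1 + u) = FormulaCells.polOf φ (3 * t + 1 + u)

/-- `above N c` is `below (N - 1) c`. [folklore] -/
theorem above_N {c : ℕ} (hN : 0 < N φ) : above φ (N φ) c = below φ (N φ - 1) c := by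
  unfold above; rw [if_neg (by omega)]

/-- **The conditions determine the chain state from its bus values and its free bit, and the bus
values are good.** [cite: LiskiewiczOgiharaToda2003, §3 (Lemma 4: "the path is determined by the assignment")] -/
theorem exists_conf_of_OK (hN : 0 < N φ) {σ : Fin (M φ) → Bool} (hA : OKA φ σ) (hB : OKB φ σ) :
    ∃ p : (Fin (N φ) → Bool) × Bool, GoodC φ p.1 ∧ σ = conf φ p := by
  obtain ⟨hA1, hA2, hA3⟩ := hA
  obtain ⟨hB1, hB2, hB3, hB4⟩ := hB
  set τ₀ : Fin (N φ) → Bool := fun r => extB σ (blIdx φ r.val 0) with hτ₀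
  set τ : ℕ → Bool := extT φ τ₀ with hτdef
  have hτ : ∀ r < N φ, τ r = extB σ (blIdx φ r 0) := fun r hr => by
    show extT φ τ₀ r = _; unfold extT; rw [dif_pos hr]
  have hab := fun c (hc : c < N φ) => uses_above_of_OK hA1 hB1 hB2 hτ hc
  -- the doors
  have hdoor : ∀ r < N φ, ∀ j < N φ, extB σ (wIdx φ r j) = ! V φ τ r (J φ r j) := by
    intro r hr j hj
    have hc := J_lt (r := r) hj
    have h := hA1 (J φ r j) hc r hr
    rw [J_J hj, hab _ hc r hr.le] at h
    revert h
    cases extB σ (wIdx φ r j) <;> cases V φ τ r (J φ r j) <;> simp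
  -- the clause cells
  have hK : ∀ c < N φ, extB σ (kIdx φ c) = ! τ c := by
    intro c hc
    have h := hA3 c hc
    rw [← above_N hN, hab c hc (N φ) le_rfl, V_N hc] at h
    revert h
    cases extB σ (kIdx φ c) <;> cases τ c <;> simp
  refine ⟨(τ₀, extB σ (zIdx φ)), ⟨?_, ?_, ?_⟩, ?_⟩
  · -- consecutive occurrences agree: the set ladders
    intro c hc p hp
    have hpc := (prev?_spec hp).1
    have h := hA2 c hc
    unfold SetOK at h
    rw [hp, Option.isSome_some, if_pos rfl, hdoor c hc _ (J_lt hc), J_J hc, V_self hp,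
      show brIdx φ c (J φ c c) = blIdx φ c (J φ c c + 1) by
        unfold blIdx brIdx; rw [show 2 * (J φ c c + 1) = 2 * J φ c c + 2 by ring],
      bus_eq hB1 hc (by have := J_lt (r := c) hc; omega), ← hτ c hc] at h
    show τ p = τ c
    revert h
    cases τ p <;> cases τ c <;> simp
  · -- the unit clause
    have h := hB3
    rw [hK 0 hN] at h
    show τ 0 = _
    revert h
    cases τ 0 <;> cases FormulaCells.polOf φ 0 <;> simp
  · -- the three-clauses
    intro t ht
    obtain ⟨u, hu, h⟩ := hB4 t ht
    refine ⟨u, hu, ?_⟩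
    rw [hK _ (by unfold T at ht; omega)] at h
    show τ (3 * t + 1 + u) = _
    revert h
    cases τ (3 * t + 1 + u) <;> cases FormulaCells.polOf φ (3 * t + 1 + u) <;> simp
  · -- the state is the configuration
    funext ⟨i, hi⟩
    show σ ⟨i, hi⟩ = confFun φ τ (extB σ (zIdx φ)) i
    have hσi : extB σ i = σ ⟨i, hi⟩ := by unfold extB; rw [dif_pos hi]
    rw [← hσi]
    rcases cell_cases hi with h1 | ⟨r, hr, k, hk, rfl⟩ | ⟨c, hc, rfl⟩ | rfl
    · rw [hB2 i h1, confFun_dummy h1]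
    · rw [confFun_rowCell hr hk]
      by_cases he : k % 2 = 0
      · rw [if_pos he, show rowCell φ r k = blIdx φ r (k / 2) by unfold blIdx; congr 1; omega,
          bus_eq hB1 hr (show k / 2 ≤ N φ by omega), hτ r hr]
      · rw [if_neg he, show rowCell φ r k = wIdx φ r (k / 2) by unfold wIdx; congr 1; omega,
          hdoor r hr _ (by omega)]
    · rw [hK c hc, confFun_k hc, V_N hc]
    · rw [confFun_z]

/-- **A configuration of a good bus assignment satisfies the conditions.** [folklore] -/
theorem OK_conf (hN : 0 < N φ) {p : (Fin (N φ) → Bool) × Bool} (hg : GoodC φ p.1) : OKA φ (conf φ p) ∧ OKB φ (conf φ p) := by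
  obtain ⟨hg1, hg2, hg3⟩ := hg
  set τ : ℕ → Bool := extT φ p.1 with hτdef
  have hσ : ∀ i < M φ, extB (conf φ p) i = confFun φ τ p.2 i := fun i hi => extB_conf p hi
  have hab := fun c (hc : c < N φ) => uses_above_conf hσ hc
  refine ⟨⟨fun c hc r hr => ?_, fun c hc => ?_, fun c hc => ?_⟩, ⟨fun r hr j hj => ?_, fun d hd => ?_, ?_, fun t ht => ?_⟩⟩
  · rw [hσ (wIdx φ r (J φ r c)) (rowCell_lt_M hr (by have := J_lt (r := r) hc; omega)), confFun_w hr (J_lt hc), J_J hc,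
      hab c hc r hr.le]
    cases V φ τ r c <;> simp
  · unfold SetOK
    have hj := J_lt (r := c) hc
    cases hp : prev? φ c with
    | none =>
      rw [Option.isSome_none, if_neg Bool.false_ne_true, hσ _ (dIdx_lt_M hc), hσ _ (d'Idx_lt_M hc),
        confFun_dummy (dIdx_lt hc), confFun_dummy (d'Idx_lt hc)]
      simp
    | some q =>
      rw [Option.isSome_some, if_pos rfl, hσ (wIdx φ c (J φ c c)) (rowCell_lt_M hc (by omega)),
        hσ (brIdx φ c (J φ c c)) (rowCell_lt_M hc (by omega)),
        confFun_w hc hj, J_J hc, V_self hp, confFun_br hc hj, hg1 c hc q hp]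
      cases τ c <;> simp
  · rw [← above_N hN, hab c hc (N φ) le_rfl, hσ _ (kIdx_lt_M hc), confFun_k hc]
    cases V φ τ (N φ) c <;> simp
  · rw [hσ (blIdx φ r j) (rowCell_lt_M hr (by omega)), hσ (brIdx φ r j) (rowCell_lt_M hr (by omega)), confFun_bl hr hj.le,
      confFun_br hr hj]
  · rw [hσ _ (by unfold M; omega), confFun_dummy hd]
  · rw [hσ _ (kIdx_zero_lt_M φ), confFun_k hN, V_N hN, hg2]
  · obtain ⟨u, hu, h⟩ := hg3 t ht
    have hc : 3 * t + 1 + u < N φ := by unfold T at ht; omega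
    refine ⟨u, hu, ?_⟩
    rw [hσ _ (kIdx_lt_M hc), confFun_k hc, V_N hc, h]

/-- **The collapsed constraint characterised**: the chain states passing every census are exactly the
configurations of the good bus assignments, with a free bit. [cite: LiskiewiczOgiharaToda2003, §3 (Lemma 4)] -/
theorem Φ₁_iff_exists (hN : 0 < N φ) (σ : Fin (M φ) → Bool) :
    Φ₁ φ σ ↔ ∃ p : (Fin (N φ) → Bool) × Bool, GoodC φ p.1 ∧ σ = conf φ p := by
  rw [Φ₁_iff]
  constructor
  · rintro ⟨hA, hB⟩; exact exists_conf_of_OK hN hA hB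
  · rintro ⟨p, hg, rfl⟩; exact OK_conf hN hg

/-! ### Counting the configurations -/

/-- **The configuration map is injective** (the first bus cell of row `r` reads `τ r`, the free cell reads `z`). [folklore] -/
theorem conf_injective : Function.Injective (conf φ) := by
  rintro ⟨τ, z⟩ ⟨τ', z'⟩ h
  have hc : ∀ i, i < M φ → confFun φ (extT φ τ) z i = confFun φ (extT φ τ') z' i := fun i hi => congrFun h ⟨i, hi⟩
  have hτ : τ = τ' := by
    funext ⟨r, hr⟩
    have := hc (blIdx φ r 0) (rowCell_lt_M hr (by omega))
    rw [confFun_bl hr (Nat.zero_le _), confFun_bl hr (Nat.zero_le _)] at this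
    unfold extT at this
    rwa [dif_pos hr, dif_pos hr] at this
  have hz : z = z' := by
    have := hc (zIdx φ) zIdx_lt
    rwa [confFun_z, confFun_z] at this
  rw [hτ, hz]

open Classical in
/-- **The chain states passing every census are twice as many as the good bus assignments.** [folklore] -/
theorem card_filter_Φ₁ (hN : 0 < N φ) :
    (univ.filter (Φ₁ φ)).card = 2 * (univ.filter (GoodC φ)).card := by
  have hS : univ.filter (Φ₁ φ) = ((univ.filter (GoodC φ)) ×ˢ (univ : Finset Bool)).image (conf φ) := by
    ext σ
    simp only [mem_filter, mem_univ, true_and, mem_image, mem_product, and_true]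
    rw [Φ₁_iff_exists hN]
    constructor
    · rintro ⟨p, hg, rfl⟩; exact ⟨p, hg, rfl⟩
    · rintro ⟨p, hg, rfl⟩; exact ⟨p, hg, rfl⟩
  rw [hS, card_image_of_injective _ conf_injective, card_product, card_univ, Fintype.card_bool, mul_comm]

/-! ### Good bus assignments are good state vectors -/

/-- **The previous occurrence is the last earlier cell of the variable**: every earlier cell of the
variable is at or before it. [folklore] -/
theorem prev?_ge {c d : ℕ} (hdc : d < c) (hv : FormulaCells.varOf φ d = FormulaCells.varOf φ c) :
    ∃ p, prev? φ c = some p ∧ d ≤ p := by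
  unfold prev?
  set L := (List.range c).filter (fun d => FormulaCells.varOf φ d = FormulaCells.varOf φ c) with hL
  have hd : d ∈ L := by
    rw [hL, List.mem_filter, List.mem_range, decide_eq_true_eq]; exact ⟨hdc, hv⟩
  have hne : L ≠ [] := List.ne_nil_of_mem hd
  refine ⟨L.getLast hne, List.getLast?_eq_getLast_of_ne_nil hne, ?_⟩
  have hP : List.Pairwise (· < ·) L := List.pairwise_lt_range.filter _
  rw [← List.dropLast_append_getLast hne, List.pairwise_append] at hP
  have hd' := hd
  rw [← List.dropLast_append_getLast hne, List.mem_append, List.mem_singleton] at hd'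
  rcases hd' with h | h
  · exact (hP.2.2 d h _ (List.mem_singleton_self _)).le
  · exact h.le

/-- The extension reads `τ` below `N`. [folklore] -/
theorem extT_eq (τ : Fin (N φ) → Bool) {n : ℕ} (h : n < N φ) : extT φ τ n = τ ⟨n, h⟩ := by
  unfold extT; rw [dif_pos h]

/-- **Uniformity is agreement of consecutive occurrences.** [folklore] -/
theorem uniform_iff_prev (τ : Fin (N φ) → Bool) :
    FormulaCells.Uniform φ τ ↔ ∀ c < N φ, ∀ p, prev? φ c = some p → extT φ τ p = extT φ τ c := by
  constructor
  · intro hu c hc p hp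
    obtain ⟨hpc, hv⟩ := prev?_spec hp
    rw [extT_eq τ (hpc.trans hc), extT_eq τ hc]
    exact hu ⟨p, hpc.trans hc⟩ ⟨c, hc⟩ hv
  · intro h
    -- earlier cells of the variable of `c` agree with `c`, by strong induction on `c`
    have key : ∀ c, c < N φ → ∀ d < c, FormulaCells.varOf φ d = FormulaCells.varOf φ c → extT φ τ d = extT φ τ c := by
      intro c
      induction c using Nat.strong_induction_on with
      | _ c ih =>
        intro hc d hdc hv
        obtain ⟨p, hp, hdp⟩ := prev?_ge hdc hv
        obtain ⟨hpc, hvp⟩ := prev?_spec hp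
        rw [← h c hc p hp]
        rcases Nat.lt_or_ge d p with hlt | hge
        · exact ih p hpc (hpc.trans hc) d hlt (hv.trans hvp.symm)
        · rw [show d = p by omega]
    intro c c' hv
    rcases Nat.lt_trichotomy c.val c'.val with hlt | heq | hgt
    · have := key c'.val c'.isLt c.val hlt hv
      rwa [extT_eq τ c.isLt, extT_eq τ c'.isLt] at this
    · rw [Fin.ext heq]
    · have := key c.val c.isLt c'.val hgt hv.symm
      rw [extT_eq τ c.isLt, extT_eq τ c'.isLt] at this
      exact this.symm

section normalForm

variable {l : Literal ℕ} {rest : CNF ℕ}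

/-- Flattening three-literal clauses triples the length. [folklore] -/
theorem length_flatten_three {L : List (Clause ℕ)} (h : ∀ C ∈ L, C.length = 3) : L.flatten.length = 3 * L.length := by
  induction L with
  | nil => rfl
  | cons C L ih =>
    rw [List.flatten_cons, List.length_append, List.length_cons, h C (by simp), ih fun C' hC' => h C' (by simp [hC'])]
    ring

/-- The number of cells of a formula in normal form. [folklore] -/
theorem N_normalForm (h3 : ∀ C ∈ rest, C.length = 3) : N ([l] :: rest) = 3 * rest.length + 1 := by
  show (FormulaCells.cells ([l] :: rest)).length = _
  unfold FormulaCells.cells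
  rw [List.flatten_cons, List.length_append, length_flatten_three h3]
  simp; ring

/-- The number of three-clauses of a formula in normal form. [folklore] -/
theorem T_normalForm (h3 : ∀ C ∈ rest, C.length = 3) : T ([l] :: rest) = rest.length := by
  unfold T; rw [N_normalForm h3]; omega

/-- The first cell of clause `t + 1` of a formula in normal form. [folklore] -/
theorem start_succ_normalForm (h3 : ∀ C ∈ rest, C.length = 3) {t : ℕ} (ht : t ≤ rest.length) :
    FormulaCells.start ([l] :: rest) (t + 1) = 3 * t + 1 := by
  unfold FormulaCells.start
  rw [List.take_succ_cons, List.flatten_cons, List.length_append,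
    length_flatten_three fun C hC => h3 C (List.mem_of_mem_take hC), List.length_take_of_le ht]
  simp; ring

/-- The first cell of clause `0`. [folklore] -/
theorem start_zero (ψ : CNF ℕ) : FormulaCells.start ψ 0 = 0 := by
  simp [FormulaCells.start]

/-- **Cell-wise goodness is goodness**, for a formula in normal form. [folklore] -/
theorem goodC_iff_good (h3 : ∀ C ∈ rest, C.length = 3) (τ : Fin (N ([l] :: rest)) → Bool) :
    GoodC ([l] :: rest) τ ↔ FormulaCells.Good ([l] :: rest) τ := by
  rw [FormulaCells.good_iff, uniform_iff_prev]
  unfold GoodC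
  refine and_congr_right fun _ => ?_
  have hN := N_normalForm (l := l) h3
  have hT := T_normalForm (l := l) h3
  constructor
  · rintro ⟨h0, h⟩ j hj
    rcases j with _ | t
    · refine ⟨0, by simp, ?_⟩
      rw [← extT_eq τ]
      simpa [start_zero] using h0
    · have ht : t < rest.length := by simpa using hj
      obtain ⟨u, hu, h'⟩ := h t (by rw [hT]; exact ht)
      have hlen : (([l] :: rest)[t + 1]'hj).length = 3 := h3 _ (by simp)
      refine ⟨u, by rw [hlen]; exact hu, ?_⟩
      rw [← extT_eq τ]
      simp only [start_succ_normalForm h3 ht.le]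
      exact h'
  · intro h
    constructor
    · obtain ⟨i, hi, h0⟩ := h 0 (by simp)
      have hi0 : i = 0 := by simp at hi; exact hi
      subst hi0
      rw [← extT_eq τ] at h0
      simpa [start_zero] using h0
    · intro t ht
      rw [hT] at ht
      obtain ⟨i, hi, h'⟩ := h (t + 1) (by simp; exact ht)
      have hlen : (([l] :: rest)[t + 1]'(by simp; exact ht)).length = 3 := h3 _ (by simp)
      refine ⟨i, by rw [hlen] at hi; exact hi, ?_⟩
      rw [← extT_eq τ] at h'
      simp only [start_succ_normalForm h3 ht.le] at h'
      exact h'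

end normalForm

open Classical in
/-- **The number of chain states passing every census is `2 · #SAT(φ)`** for `φ` in the normal form
of Lemma 3. [cite: LiskiewiczOgiharaToda2003, §3 (Lemma 4)] -/
theorem card_filter_Φ₁_eq (hφ : CNF.IsLOTNormalForm φ) : (univ.filter (Φ₁ φ)).card = 2 * φ.numSat := by
  obtain ⟨l, rest, rfl, hcp⟩ := hφ.exists_eq
  have h3 := hcp.length_eq_three
  have hN : 0 < N ([l] :: rest) := by rw [N_normalForm h3]; omega
  rw [card_filter_Φ₁ hN, ← FormulaCells.card_good_eq_numSat]
  congr 2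
  exact filter_congr fun τ _ => goodC_iff_good h3 τ

open Classical in
/-- **The number of Hamiltonian `0 – (5M-1)` paths of the graph of `φ` is `2 · #SAT(φ)`** for `φ`
in the normal form of Lemma 3. [cite: LiskiewiczOgiharaToda2003, §3 (Lemma 4)] -/
theorem hamCount_graph₂_eq (hφ : CNF.IsLOTNormalForm φ) :
    hamCount (graph₂ φ) (verts₂ φ) 0 (5 * M φ - 1) = 2 * φ.numSat := by
  rw [hamCount_graph₂_eq_card, card_filter_Φ₁_eq hφ]

end LOTReduction

end Literature.Combinatorics.SimpleGraph
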